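import Mathlib
import Literature.Analysis.FluidPDE.SuitableWeak
import Literature.Analysis.FluidPDE.CriticalRegularityScaling
import Summits.NavierStokesRegularity.NavierStokesRegularity.Theorems.EulerZoomLiouvillePowerGaugeEulerLiouvilleBackwardTools
import Summits.NavierStokesRegularity.NavierStokesRegularity.Theorems.EulerZoomLiouvillePowerGaugeEulerLiouvillePastSymmetric
import HarnessLib

/-!
# Crux E `PowerGaugeEulerLiouville` (stmt-NavierStokesRegularity-19832): SHAPE-PRESERVING members with a FAST CLOCK are trivial

Route `EulerZoomLiouville` (NavierStokesRegularity), crux E = Seregin's power-gauged ancient-Euler Liouville statement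
(suitable weak Euler pair `(u, p)` on the slab `(−∞,0) × ℝ³`, weak spatial gradient `H`, gauges
`a^{2ρ} A(a) + a^{ρ} E(a) + a^{2ρ} D(a) ≤ c` at the origin, `ρ > 0`).  A WEAK-CLASS stratum (no regularity, no Euler
identity used beyond the class's backward energy monotonicity in the last step): members that are SHAPE-PRESERVING on
a past sub-slab, `u(τ, y) = θ(τ) V(y/ℓ(τ))` for `τ < T₁ ≤ 0` with a fixed profile `V : ℝ³ → ℝ³` (ARBITRARY: no
measurability, integrability or regularity assumed) and ARBITRARY amplitude / length clocks `θ, ℓ > 0`, die as soon as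
the clock is FAST in the sense of the `A`-gauge:

* ENGINE `PastShape.ae_eq_zero_of_gauge_of_fastClockPast`: the slice bound `∫_{B_a}|u(τ)|² ≤ c a^{1−2ρ}` (`τ ∈ (−a²,0)`,
  `Backward.lintegral_ball_le_of_gaugeA`) reads `θ(τ)² ℓ(τ)³ ∫_{B_{a/ℓ(τ)}} |V|² ≤ c a^{1−2ρ}`; if for every radius `R`
  and every `ε > 0` some time `τ < T₁` and some admissible scale `a` (`a² > −τ`, `a ≥ R ℓ(τ)`) have
  `a^{1−2ρ} ≤ ε θ(τ)² ℓ(τ)³`, then `∫_{B_R}|V|² = 0` for every `R`, every slice `u(τ)`, `τ < T₁`, has zero energy, and the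
  member vanishes by the energy stratum (`PastSymmetric.ae_eq_zero_of_gauge_of_pastSlicesZero`).
* `PastShape.ae_eq_zero_of_gauge_of_pastExpandingBreather`: LOG-TIME BREATHERS EXPANDING INTO THE PAST,
  `u(τ, y) = e^{c'τ} V(e^{−c'τ} y)` for `τ < T₁` with `c' < 0` (exponential self-similarity, the `α = −1` endpoint of
  Euler's scaling family — line `logtime-breathers` of crux E, stub T2a, here in PAST form and for an arbitrary profile).
* `PastShape.ae_eq_zero_of_gauge_of_pastFastPowerClock`: FAST POWER CLOCKS, `u(τ, y) = (T₀−τ)^{g−1} V((T₀−τ)^{−g} y)` for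
  `τ < T₁` (`T₁ ≤ 0`, `T₁ ≤ T₀`) with exponent `g > 1/2 − ρ/5` — exactly self-similar about ANY time `T₀ ≥ T₁` with a clock
  faster than the `A`-gauge tolerates (the class exponent `γ = 1/(2+ρ)` satisfies `γ ≤ 1/2 − ρ/5`, with equality iff
  `ρ = 1/2`: at the energy-conserving endpoint every exponent `g > γ` is excluded, profile-free).

Arithmetic behind the two corollaries: for the breather `θ = ℓ = e^{c'τ} → ∞` as `τ → −∞`, take `a = R e^{c'τ}`; for the
power clock with `s = T₀ − τ → ∞` take `a = (R+2) s^{max(g,1/2)}`, and `a^{1−2ρ}/(θ²ℓ³) = O(s^{−e})` with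
`e = g(4+2ρ) − 2 ≥ ρ` (`g ≥ 1/2`) resp. `e = 5(g − 1/2 + ρ/5)` (`g < 1/2`).
WHAT THIS IS NOT: not NS regularity, not the crux E — one more weak stratum for the lead skeleton
`Cruxes/PowerGaugeEulerLiouville/Lines/birth.lean` (interim LEAD ns-typeII-p2 g10); the class-exponent clock `g = γ`
(the registered self-similar residue) is untouched. [folklore; line card `Cruxes/PowerGaugeEulerLiouville/Lines/logtime-breathers.md` T2a/T4]
-/

noncomputable section

set_option linter.dupNamespace false

open MeasureTheory Set Filter Topology Metric Function
open scoped ENNReal NNReal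

namespace Summit.NavierStokesRegularity.NavierStokesRegularity.Theorems.PowerGaugeEulerLiouville.PastShape

open Literature.Analysis Literature.Analysis.FluidPDE

/-- **Energy of a shape-preserving slice on a ball.**  `∫_{B_a} |θ V(y/ℓ)|² dy = θ² ℓ³ ∫_{B_{a/ℓ}} |V|²` (`ℓ > 0`;
no measurability of `V` needed). [folklore] -/
theorem lintegral_ball_shape {θ ℓ : ℝ} (hℓ : 0 < ℓ) (V : EuclideanSpace ℝ (Fin 3) → EuclideanSpace ℝ (Fin 3))
    (a : ℝ) :
    ∫⁻ y in ball (0 : EuclideanSpace ℝ (Fin 3)) a, ‖θ • V (ℓ⁻¹ • y)‖ₑ ^ 2 =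
      ENNReal.ofReal (θ ^ 2 * ℓ ^ 3) *
        ∫⁻ z in ball (0 : EuclideanSpace ℝ (Fin 3)) (ℓ⁻¹ * a), ‖V z‖ₑ ^ 2 := by
  have hθ : ∀ y : EuclideanSpace ℝ (Fin 3),
      ‖θ • V (ℓ⁻¹ • y)‖ₑ ^ 2 = ENNReal.ofReal (θ ^ 2) * ‖V (ℓ⁻¹ • y)‖ₑ ^ 2 := by
    intro y
    rw [enorm_smul, mul_pow, Real.enorm_eq_ofReal_abs, ← ENNReal.ofReal_pow (abs_nonneg θ), sq_abs]
  simp_rw [hθ]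
  rw [lintegral_const_mul' _ _ ENNReal.ofReal_ne_top,
    setLIntegral_ball_center_comp_smul (fun z : EuclideanSpace ℝ (Fin 3) => ‖V z‖ₑ ^ 2) (inv_pos.2 hℓ)
      (0 : EuclideanSpace ℝ (Fin 3)) a,
    smul_zero, finrank_euclideanSpace_fin, inv_pow, inv_inv, ← mul_assoc,
    ← ENNReal.ofReal_mul (sq_nonneg θ)]

variable {ρ : ℝ} {u : ℝ → EuclideanSpace ℝ (Fin 3) → EuclideanSpace ℝ (Fin 3)}
  {p : ℝ → EuclideanSpace ℝ (Fin 3) → ℝ}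
  {H : ℝ → EuclideanSpace ℝ (Fin 3) → EuclideanSpace ℝ (Fin 3) →L[ℝ] EuclideanSpace ℝ (Fin 3)} {c : ℝ≥0}

/-- **ENGINE: shape-preserving members with an `A`-fast clock are trivial.**  Let `(u, p, H, c)` be a member of the
power-gauged class (`ρ > 0`) which is SHAPE-PRESERVING on a past sub-slab: `u(τ, y) = θ(τ) V(y/ℓ(τ))` for every
`τ < T₁` (`T₁ ≤ 0`), with `ℓ(τ) > 0` and an arbitrary profile `V`.  If for every radius `R > 0` and every `ε > 0` there are
a time `τ < T₁` and a scale `a` with `a² > −τ`, `a ≥ R ℓ(τ)` and `a^{1−2ρ} ≤ ε θ(τ)² ℓ(τ)³`, then `u = 0` a.e. on the slab: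
the `A`-gauge slice bound `θ² ℓ³ ∫_{B_{a/ℓ}}|V|² ≤ c a^{1−2ρ}` gives `∫_{B_R}|V|² ≤ c ε` for every `ε`, so the profile has
zero energy on every ball, every slice before `T₁` has zero energy, and the energy stratum
(`PastSymmetric.ae_eq_zero_of_gauge_of_pastSlicesZero`) concludes. [folklore] -/
theorem ae_eq_zero_of_gauge_of_fastClockPast (hρ : 0 < ρ)
    (hsw : IsSuitableWeakSolutionOn (slab (EuclideanSpace ℝ (Fin 3)) (Iio 0) isOpen_Iio) 0 0 u p)
    (hH : HasWeakSpatialGradientOn (slab (EuclideanSpace ℝ (Fin 3)) (Iio 0) isOpen_Iio) u H)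
    (hc : ∀ a : ℝ, 0 < a → ENNReal.ofReal (a ^ (2 * ρ)) * cknA a (0 : ℝ × EuclideanSpace ℝ (Fin 3)) u +
        ENNReal.ofReal (a ^ ρ) * cknE a (0 : ℝ × EuclideanSpace ℝ (Fin 3)) H +
        ENNReal.ofReal (a ^ (2 * ρ)) * cknD a (0 : ℝ × EuclideanSpace ℝ (Fin 3)) p ≤ (c : ℝ≥0∞))
    {T₁ : ℝ} (hT₁ : T₁ ≤ 0) {θ ℓ : ℝ → ℝ} {V : EuclideanSpace ℝ (Fin 3) → EuclideanSpace ℝ (Fin 3)}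
    (hℓ : ∀ τ : ℝ, τ < T₁ → 0 < ℓ τ)
    (hshape : ∀ τ : ℝ, τ < T₁ → ∀ y, u τ y = θ τ • V ((ℓ τ)⁻¹ • y))
    (hfast : ∀ R : ℝ, 0 < R → ∀ ε : ℝ, 0 < ε → ∃ τ : ℝ, τ < T₁ ∧ ∃ a : ℝ,
        -τ < a ^ 2 ∧ R * ℓ τ ≤ a ∧ a ^ (1 - 2 * ρ) ≤ ε * (θ τ ^ 2 * ℓ τ ^ 3)) :
    uncurry u =ᵐ[volume.restrict (Iio (0 : ℝ) ×ˢ (univ : Set (EuclideanSpace ℝ (Fin 3))))] 0 := by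
  have hA : ∀ a : ℝ, 0 < a → ENNReal.ofReal (a ^ (2 * ρ)) *
      cknA a (0 : ℝ × EuclideanSpace ℝ (Fin 3)) u ≤ (c : ℝ≥0∞) :=
    fun a ha => le_trans (le_trans le_self_add le_self_add) (hc a ha)
  -- ## the `A`-gauge slice bound in shape form
  have hkey : ∀ τ : ℝ, τ < T₁ → ∀ a : ℝ, 0 < a → -τ < a ^ 2 →
      ENNReal.ofReal (θ τ ^ 2 * ℓ τ ^ 3) *
          ∫⁻ z in ball (0 : EuclideanSpace ℝ (Fin 3)) ((ℓ τ)⁻¹ * a), ‖V z‖ₑ ^ 2 ≤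
        ENNReal.ofReal ((c : ℝ) * a ^ (1 - 2 * ρ)) := by
    intro τ hτ a ha hτa
    have hs : τ ∈ Ioo (-(a ^ 2)) 0 := ⟨by linarith, lt_of_lt_of_le hτ hT₁⟩
    have h1 := Backward.lintegral_ball_le_of_gaugeA ha (hA a ha) hs
    have h2 : ∫⁻ x in ball (0 : EuclideanSpace ℝ (Fin 3)) a, ‖u τ x‖ₑ ^ 2 =
        ∫⁻ x in ball (0 : EuclideanSpace ℝ (Fin 3)) a, ‖θ τ • V ((ℓ τ)⁻¹ • x)‖ₑ ^ 2 :=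
      lintegral_congr fun x => by rw [hshape τ hτ x]
    rwa [h2, lintegral_ball_shape (hℓ τ hτ)] at h1
  -- ## Step 1: the profile has zero energy on every ball
  have hI : ∀ R : ℝ, 0 < R → ∫⁻ z in ball (0 : EuclideanSpace ℝ (Fin 3)) R, ‖V z‖ₑ ^ 2 = 0 := by
    intro R hR
    refine le_antisymm (ENNReal.le_of_forall_pos_le_add fun ε hε _ => ?_) bot_le
    rw [zero_add]
    set ε' : ℝ := (ε : ℝ) / ((c : ℝ) + 1) with hε'
    have hc0 : (0 : ℝ) ≤ c := c.coe_nonneg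
    have hε0 : (0 : ℝ) < ε := by exact_mod_cast hε
    have hε'pos : 0 < ε' := by positivity
    obtain ⟨τ, hτ, a, hτa, hRa, hfa⟩ := hfast R hR ε' hε'pos
    have hℓτ : 0 < ℓ τ := hℓ τ hτ
    have ha : 0 < a := lt_of_lt_of_le (mul_pos hR hℓτ) hRa
    have hX : 0 < θ τ ^ 2 * ℓ τ ^ 3 := by
      have hapos : 0 < a ^ (1 - 2 * ρ) := Real.rpow_pos_of_pos ha _
      exact pos_of_mul_pos_right (lt_of_lt_of_le hapos hfa) hε'pos.le
    have hmono : ∫⁻ z in ball (0 : EuclideanSpace ℝ (Fin 3)) R, ‖V z‖ₑ ^ 2 ≤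
        ∫⁻ z in ball (0 : EuclideanSpace ℝ (Fin 3)) ((ℓ τ)⁻¹ * a), ‖V z‖ₑ ^ 2 := by
      refine lintegral_mono_set (ball_subset_ball ?_)
      rw [le_inv_mul_iff₀ hℓτ, mul_comm]
      exact hRa
    have h1 : ENNReal.ofReal (θ τ ^ 2 * ℓ τ ^ 3) *
        ∫⁻ z in ball (0 : EuclideanSpace ℝ (Fin 3)) R, ‖V z‖ₑ ^ 2 ≤
        ENNReal.ofReal (θ τ ^ 2 * ℓ τ ^ 3) * ENNReal.ofReal ((c : ℝ) * ε') :=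
      calc ENNReal.ofReal (θ τ ^ 2 * ℓ τ ^ 3) * ∫⁻ z in ball (0 : EuclideanSpace ℝ (Fin 3)) R, ‖V z‖ₑ ^ 2
          ≤ ENNReal.ofReal (θ τ ^ 2 * ℓ τ ^ 3) *
              ∫⁻ z in ball (0 : EuclideanSpace ℝ (Fin 3)) ((ℓ τ)⁻¹ * a), ‖V z‖ₑ ^ 2 := by gcongr
        _ ≤ ENNReal.ofReal ((c : ℝ) * a ^ (1 - 2 * ρ)) := hkey τ hτ a ha hτa
        _ ≤ ENNReal.ofReal ((c : ℝ) * (ε' * (θ τ ^ 2 * ℓ τ ^ 3))) := by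
            apply ENNReal.ofReal_le_ofReal; gcongr
        _ = ENNReal.ofReal (θ τ ^ 2 * ℓ τ ^ 3) * ENNReal.ofReal ((c : ℝ) * ε') := by
            rw [← ENNReal.ofReal_mul hX.le]; ring_nf
    have h2 : ∫⁻ z in ball (0 : EuclideanSpace ℝ (Fin 3)) R, ‖V z‖ₑ ^ 2 ≤ ENNReal.ofReal ((c : ℝ) * ε') :=
      (ENNReal.mul_le_mul_iff_right ((ENNReal.ofReal_pos.2 hX).ne') ENNReal.ofReal_ne_top).1 h1
    refine h2.trans ?_
    rw [← ENNReal.ofReal_coe_nnreal]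
    apply ENNReal.ofReal_le_ofReal
    rw [hε', mul_div_assoc', div_le_iff₀ (by positivity)]
    nlinarith
  -- ## Step 2: every slice before `T₁` has zero energy
  have hslice0 : ∀ τ : ℝ, τ < T₁ → ∫⁻ x, ‖u τ x‖ₑ ^ 2 = 0 := by
    intro τ hτ
    have hℓτ : 0 < ℓ τ := hℓ τ hτ
    have hball : ∀ n : ℕ, ∫⁻ x in ball (0 : EuclideanSpace ℝ (Fin 3)) n, ‖u τ x‖ₑ ^ 2 = 0 := by
      intro n
      have h2 : ∫⁻ x in ball (0 : EuclideanSpace ℝ (Fin 3)) n, ‖u τ x‖ₑ ^ 2 =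
          ENNReal.ofReal (θ τ ^ 2 * ℓ τ ^ 3) *
            ∫⁻ z in ball (0 : EuclideanSpace ℝ (Fin 3)) ((ℓ τ)⁻¹ * n), ‖V z‖ₑ ^ 2 := by
        rw [← lintegral_ball_shape hℓτ]
        exact lintegral_congr fun x => by rw [hshape τ hτ x]
      rw [h2]
      rcases Nat.eq_zero_or_pos n with hn | hn
      · subst hn
        simp
      · rw [hI _ (by positivity), mul_zero]
    refine le_antisymm ?_ bot_le
    calc ∫⁻ x, ‖u τ x‖ₑ ^ 2
        = ∫⁻ x in (⋃ n : ℕ, ball (0 : EuclideanSpace ℝ (Fin 3)) n), ‖u τ x‖ₑ ^ 2 := by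
          rw [iUnion_ball_nat, Measure.restrict_univ]
      _ ≤ ∑' n : ℕ, ∫⁻ x in ball (0 : EuclideanSpace ℝ (Fin 3)) n, ‖u τ x‖ₑ ^ 2 := lintegral_iUnion_le _ _
      _ = 0 := by simp [hball]
  -- ## Step 3: the energy stratum
  exact PastSymmetric.ae_eq_zero_of_gauge_of_pastSlicesZero hρ.le hsw hH hc (T₁ := T₁)
    ((ae_restrict_iff' measurableSet_Iio).2 (ae_of_all _ fun τ hτ => hslice0 τ hτ))

/-- **LOG-TIME BREATHERS EXPANDING INTO THE PAST are trivial.**  A member of the power-gauged class (`0 < ρ ≤ 1/2`) with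
`u(τ, y) = e^{c'τ} V(e^{−c'τ} y)` for every `τ < T₁` (`T₁ ≤ 0`), `c' < 0`, `V : ℝ³ → ℝ³` arbitrary, vanishes a.e. on the
slab: with `θ = ℓ = e^{c'τ} → ∞` as `τ → −∞` and `a = R e^{c'τ}`, `a^{1−2ρ}/(θ²ℓ³) ≤ R e^{−4c'τ}… → 0` while `a² > −τ`
eventually.  (Line `logtime-breathers`, stub T2a — past form, weak class.) [folklore] -/
theorem ae_eq_zero_of_gauge_of_pastExpandingBreather (hρ : 0 < ρ) (hρh : ρ ≤ 1 / 2)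
    (hsw : IsSuitableWeakSolutionOn (slab (EuclideanSpace ℝ (Fin 3)) (Iio 0) isOpen_Iio) 0 0 u p)
    (hH : HasWeakSpatialGradientOn (slab (EuclideanSpace ℝ (Fin 3)) (Iio 0) isOpen_Iio) u H)
    (hc : ∀ a : ℝ, 0 < a → ENNReal.ofReal (a ^ (2 * ρ)) * cknA a (0 : ℝ × EuclideanSpace ℝ (Fin 3)) u +
        ENNReal.ofReal (a ^ ρ) * cknE a (0 : ℝ × EuclideanSpace ℝ (Fin 3)) H +
        ENNReal.ofReal (a ^ (2 * ρ)) * cknD a (0 : ℝ × EuclideanSpace ℝ (Fin 3)) p ≤ (c : ℝ≥0∞))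
    {T₁ : ℝ} (hT₁ : T₁ ≤ 0) {c' : ℝ} (hc' : c' < 0) {V : EuclideanSpace ℝ (Fin 3) → EuclideanSpace ℝ (Fin 3)}
    (hu : ∀ τ : ℝ, τ < T₁ → ∀ y, u τ y = Real.exp (c' * τ) • V (Real.exp (-(c' * τ)) • y)) :
    uncurry u =ᵐ[volume.restrict (Iio (0 : ℝ) ×ˢ (univ : Set (EuclideanSpace ℝ (Fin 3))))] 0 := by
  refine ae_eq_zero_of_gauge_of_fastClockPast hρ hsw hH hc hT₁ (θ := fun τ => Real.exp (c' * τ))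
    (ℓ := fun τ => Real.exp (c' * τ)) (V := V) (fun τ _ => Real.exp_pos _)
    (fun τ hτ y => by rw [hu τ hτ y, Real.exp_neg]) ?_
  intro R hR ε hε
  set k : ℝ := -c' with hk
  have hk0 : 0 < k := by rw [hk]; linarith
  -- the time: `s = -τ` beyond every threshold
  set S : ℝ := max (max (1 / (R ^ 2 * k ^ 2)) (1 / (k * R))) (max (R / (ε * k)) 1) with hS
  set s : ℝ := S + (-T₁) + 1 with hs
  have hS1 : 1 / (R ^ 2 * k ^ 2) ≤ s := by
    have : 1 / (R ^ 2 * k ^ 2) ≤ S := le_trans (le_max_left _ _) (le_max_left _ _)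
    rw [hs]; linarith
  have hS2 : 1 / (k * R) ≤ s := by
    have : 1 / (k * R) ≤ S := le_trans (le_max_right _ _) (le_max_left _ _)
    rw [hs]; linarith
  have hS3 : R / (ε * k) ≤ s := by
    have : R / (ε * k) ≤ S := le_trans (le_max_left _ _) (le_max_right _ _)
    rw [hs]; linarith
  have hS4 : 1 ≤ s := by
    have : (1 : ℝ) ≤ S := le_trans (le_max_right _ _) (le_max_right _ _)
    rw [hs]; linarith
  have hs0 : 0 < s := by linarith
  set Ex : ℝ := Real.exp (k * s) with hEx
  have hEx1 : k * s + 1 ≤ Ex := Real.add_one_le_exp _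
  have hEks : k * s ≤ Ex := by linarith
  have hEx0 : 0 < Ex := Real.exp_pos _
  have hE1 : 1 ≤ Ex := by nlinarith [mul_pos hk0 hs0]
  have hSge : (1 : ℝ) ≤ S := le_trans (le_max_right _ _) (le_max_right _ _)
  refine ⟨-s, by rw [hs]; linarith, R * Ex, ?_, ?_, ?_⟩
  · -- `-(-s) < (R Ex)²`: `Ex ≥ k s + 1` and `s ≥ 1/(R² k²)`
    have h3 : 1 ≤ R ^ 2 * k ^ 2 * s := by
      rw [div_le_iff₀ (by positivity)] at hS1; linarith
    have hRks : 0 ≤ R * (k * s) := by positivity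
    have h5 : R * (k * s) + R ≤ R * Ex := by nlinarith
    have h6 : s ≤ (R * (k * s)) ^ 2 := by nlinarith
    have h7 : (R * (k * s)) ^ 2 + R ^ 2 ≤ (R * Ex) ^ 2 := by nlinarith
    rw [neg_neg]
    nlinarith [pow_pos hR 2]
  · show R * Real.exp (c' * -s) ≤ R * Ex
    rw [hEx, show c' * -s = k * s by rw [hk]; ring]
  · show (R * Ex) ^ (1 - 2 * ρ) ≤ ε * (Real.exp (c' * -s) ^ 2 * Real.exp (c' * -s) ^ 3)
    rw [show c' * -s = k * s by rw [hk]; ring, ← hEx]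
    have hRE1 : 1 ≤ R * Ex := by
      have h1 : 1 ≤ k * R * s := by rw [div_le_iff₀ (by positivity)] at hS2; linarith
      nlinarith [mul_pos hR hEx0]
    -- `(R Ex)^{1-2ρ} ≤ R Ex ≤ ε Ex² ≤ ε Ex² Ex³`
    have h1 : (R * Ex) ^ (1 - 2 * ρ) ≤ (R * Ex) ^ (1 : ℝ) :=
      Real.rpow_le_rpow_of_exponent_le hRE1 (by linarith)
    rw [Real.rpow_one] at h1
    have h2 : R ≤ ε * Ex := by
      have h3 : R ≤ ε * k * s := by rw [div_le_iff₀ (by positivity)] at hS3; linarith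
      nlinarith [mul_pos hε hk0]
    have hE3 : (1 : ℝ) ≤ Ex ^ 3 := one_le_pow₀ hE1
    have h3 : R * Ex ≤ ε * (Ex ^ 2 * Ex ^ 3) :=
      calc R * Ex ≤ ε * Ex * Ex := by gcongr
        _ = ε * (Ex ^ 2 * 1) := by ring
        _ ≤ ε * (Ex ^ 2 * Ex ^ 3) := by gcongr
    exact h1.trans h3

/-- **FAST POWER CLOCKS are trivial.**  A member of the power-gauged class (`0 < ρ ≤ 1/2`) which is exactly self-similar
on a past sub-slab about ANY time `T₀` with a FAST exponent — `u(τ, y) = (T₀−τ)^{g−1} V((T₀−τ)^{−g} y)` for every `τ < T₁`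
(`T₁ ≤ 0`, `T₁ ≤ T₀`), `g > 1/2 − ρ/5`, `V : ℝ³ → ℝ³` arbitrary — vanishes a.e. on the slab: with `s = T₀ − τ → ∞`,
`θ = s^{g−1}`, `ℓ = s^{g}` and `a = (R+2) s^{max(g,1/2)}` one has `a² > −τ` and `a^{1−2ρ}/(θ²ℓ³) = (R+2)^{1−2ρ} s^{−e} → 0`,
`e = 5g − 2 − max(g,½)(1−2ρ) > 0`.  The class exponent `γ = 1/(2+ρ) ≤ 1/2 − ρ/5` is NOT covered (equality iff `ρ = ½`,
where every `g > γ` is excluded).  (Line `logtime-breathers`, part of stub T4 — Euler's two-parameter scaling admits every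
exponent `g`; the gauges alone exclude the fast ones, profile-free.) [folklore] -/
theorem ae_eq_zero_of_gauge_of_pastFastPowerClock (hρ : 0 < ρ) (hρh : ρ ≤ 1 / 2)
    (hsw : IsSuitableWeakSolutionOn (slab (EuclideanSpace ℝ (Fin 3)) (Iio 0) isOpen_Iio) 0 0 u p)
    (hH : HasWeakSpatialGradientOn (slab (EuclideanSpace ℝ (Fin 3)) (Iio 0) isOpen_Iio) u H)
    (hc : ∀ a : ℝ, 0 < a → ENNReal.ofReal (a ^ (2 * ρ)) * cknA a (0 : ℝ × EuclideanSpace ℝ (Fin 3)) u +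
        ENNReal.ofReal (a ^ ρ) * cknE a (0 : ℝ × EuclideanSpace ℝ (Fin 3)) H +
        ENNReal.ofReal (a ^ (2 * ρ)) * cknD a (0 : ℝ × EuclideanSpace ℝ (Fin 3)) p ≤ (c : ℝ≥0∞))
    {T₁ T₀ g : ℝ} (hT₁ : T₁ ≤ 0) (hT₀ : T₁ ≤ T₀) (hg : 1 / 2 - ρ / 5 < g)
    {V : EuclideanSpace ℝ (Fin 3) → EuclideanSpace ℝ (Fin 3)}
    (hu : ∀ τ : ℝ, τ < T₁ → ∀ y, u τ y = (T₀ - τ) ^ (g - 1) • V ((T₀ - τ) ^ (-g) • y)) :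
    uncurry u =ᵐ[volume.restrict (Iio (0 : ℝ) ×ˢ (univ : Set (EuclideanSpace ℝ (Fin 3))))] 0 := by
  refine ae_eq_zero_of_gauge_of_fastClockPast hρ hsw hH hc hT₁ (θ := fun τ => (T₀ - τ) ^ (g - 1))
    (ℓ := fun τ => (T₀ - τ) ^ g) (V := V) (fun τ hτ => Real.rpow_pos_of_pos (by linarith) _)
    (fun τ hτ y => by rw [hu τ hτ y, Real.rpow_neg (by linarith : (0 : ℝ) ≤ T₀ - τ)]) ?_
  intro R hR ε hε
  set m : ℝ := max g (1 / 2) with hm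
  have hgm : g ≤ m := le_max_left _ _
  have hhm : 1 / 2 ≤ m := le_max_right _ _
  have hm0 : 0 ≤ m := le_trans (by norm_num) hhm
  set e : ℝ := 5 * g - 2 - m * (1 - 2 * ρ) with he
  have he0 : 0 < e := by
    rcases le_or_gt (1 / 2) g with hg2 | hg2
    · have hmg : m = g := max_eq_left hg2
      rw [he, hmg]; nlinarith
    · have hmh : m = 1 / 2 := max_eq_right hg2.le
      rw [he, hmh]; linarith
  set K : ℝ := max 1 ((R + 2) ^ (1 - 2 * ρ) / ε) with hK
  have hK1 : 1 ≤ K := le_max_left _ _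
  have hK0 : 0 ≤ K := le_trans zero_le_one hK1
  have hK2 : (R + 2) ^ (1 - 2 * ρ) / ε ≤ K := le_max_right _ _
  set S : ℝ := max (|T₀| + 1) (K ^ (1 / e)) with hS
  set s : ℝ := S + (T₀ - T₁) + 1 with hs
  have hS1 : |T₀| + 1 ≤ s := by
    have : |T₀| + 1 ≤ S := le_max_left _ _
    rw [hs]; linarith
  have hS2 : K ^ (1 / e) ≤ s := by
    have : K ^ (1 / e) ≤ S := le_max_right _ _
    rw [hs]; linarith
  have hs1 : 1 ≤ s := le_trans (by linarith [abs_nonneg T₀]) hS1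
  have hs0 : 0 < s := by linarith
  have hτs : T₀ - (T₀ - s) = s := by ring
  have hsm1 : s ^ (1 / 2 : ℝ) ≤ s ^ m := Real.rpow_le_rpow_of_exponent_le hs1 hhm
  have hsg : s ^ g ≤ s ^ m := Real.rpow_le_rpow_of_exponent_le hs1 hgm
  have hsm0 : 0 ≤ s ^ m := Real.rpow_nonneg hs0.le _
  have hsq : (s ^ (1 / 2 : ℝ)) ^ 2 = s := by
    rw [← Real.rpow_natCast, ← Real.rpow_mul hs0.le]; norm_num
  have hS0 : (0 : ℝ) ≤ S := le_trans (by positivity) (le_max_left _ _)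
  refine ⟨T₀ - s, by rw [hs]; linarith, (R + 2) * s ^ m, ?_, ?_, ?_⟩
  · -- `-(T₀ - s) < ((R+2) s^m)²`
    have h1 : s ≤ (s ^ m) ^ 2 :=
      calc s = (s ^ (1 / 2 : ℝ)) ^ 2 := hsq.symm
        _ ≤ (s ^ m) ^ 2 := pow_le_pow_left₀ (Real.rpow_nonneg hs0.le _) hsm1 2
    have h2 : -(T₀ - s) ≤ |T₀| + s := by
      have := neg_abs_le T₀; linarith
    have h3 : (2 : ℝ) ^ 2 * (s ^ m) ^ 2 ≤ ((R + 2) * s ^ m) ^ 2 := by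
      rw [mul_pow]; gcongr; linarith
    nlinarith [abs_nonneg T₀]
  · show R * (T₀ - (T₀ - s)) ^ g ≤ (R + 2) * s ^ m
    rw [hτs]
    gcongr
    · linarith
  · show ((R + 2) * s ^ m) ^ (1 - 2 * ρ) ≤
      ε * (((T₀ - (T₀ - s)) ^ (g - 1)) ^ 2 * ((T₀ - (T₀ - s)) ^ g) ^ 3)
    rw [hτs]
    have hθℓ : (s ^ (g - 1)) ^ 2 * (s ^ g) ^ 3 = s ^ e * s ^ (m * (1 - 2 * ρ)) := by
      rw [← Real.rpow_natCast (s ^ (g - 1)) 2, ← Real.rpow_natCast (s ^ g) 3, ← Real.rpow_mul hs0.le,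
        ← Real.rpow_mul hs0.le, ← Real.rpow_add hs0, ← Real.rpow_add hs0]
      congr 1
      rw [he]; push_cast; ring
    have hlhs : ((R + 2) * s ^ m) ^ (1 - 2 * ρ) = (R + 2) ^ (1 - 2 * ρ) * s ^ (m * (1 - 2 * ρ)) := by
      rw [Real.mul_rpow (by linarith) hsm0, ← Real.rpow_mul hs0.le]
    rw [hθℓ, hlhs, ← mul_assoc]
    have hpos : 0 ≤ s ^ (m * (1 - 2 * ρ)) := Real.rpow_nonneg hs0.le _
    gcongr
    -- `(R+2)^{1-2ρ} ≤ ε s^e`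
    have hKe : K ≤ s ^ e := by
      have h1 : (K ^ (1 / e)) ^ e ≤ s ^ e :=
        Real.rpow_le_rpow (Real.rpow_nonneg hK0 _) hS2 he0.le
      rwa [← Real.rpow_mul hK0, one_div_mul_cancel he0.ne', Real.rpow_one] at h1
    have h2 : (R + 2) ^ (1 - 2 * ρ) ≤ ε * K := by
      rw [div_le_iff₀ hε] at hK2; linarith
    calc (R + 2) ^ (1 - 2 * ρ) ≤ ε * K := h2
      _ ≤ ε * s ^ e := by gcongr

end Summit.NavierStokesRegularity.NavierStokesRegularity.Theorems.PowerGaugeEulerLiouville.PastShape
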